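import Literature.Topology.FourManifolds.SphereProductThomCollapse
import Literature.Topology.FourManifolds.SphereProductMiddleHomology
import HarnessLib

/-!
# Kronecker numbers of the Thom class in the model `Sᵏ × Sᵏ ⊃` tube of the diagonal

Topic `Literature/Topology/FourManifolds` (fact seat of
`Literature.Topology.FourManifolds.HomotopySphere.exists_intersectionForm_equivalent_e8Form`,
Kosinski's `E₈` plumbing, *Differential Manifolds* (1993), VI.12). Sequel of
`SphereProductThomCollapse.lean`: for `k ≥ 2` even, `X = Sᵏ × Sᵏ`, `N ⊆ X` an open neighbourhood
of the diagonal, `φ : N ≃ₜ Y`, the Thom collapse `c : X → Y⁺` and a Thom class `ξ ∈ Hᵏ(Y⁺; ℤ)`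
(`c^* ξ = g₁ + g₂`, `map_thomCollapse_thomClass`), this file computes the data entering the
Kronecker form of the `E₈` table (`HomotopySpheresE8KroneckerTable.lean`:
`HomotopySphere.exists_intersectionForm_equivalent_e8Form_of_kroneckerData`), all as proved
identities in the cap product / Kronecker pairing of the tree:

* `SphereProd.capProduct_g_fundamentalClass` — the Poincaré duals of the factors:
  `g₁ ⌢ [X] = ⟨g₁ ⌣ g₂, [X]⟩ • y₂`, `g₂ ⌢ [X] = ⟨g₂ ⌣ g₁, [X]⟩ • y₁` (coefficients read by
  `⟨g_b, gₐ ⌢ [X]⟩ = ⟨gₐ ⌣ g_b, [X]⟩`, `gₐ² = 0`);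
* `SphereProd.map_diagX_fundamentalClass` — `diag₊[S] = y₁ + y₂`; `map_horizSliceAt_fundamentalClass`,
  `map_vertSliceAt_fundamentalClass` — every slice `x ↦ (x, e)`, `x ↦ (e, x)` carries `y₁`, `y₂`;
* `SphereProd.capProduct_thomClass_map_fundamentalClass` — **`ξ ⌢ c₊[X] = r • c₊(y₁ + y₂)`**
  with `r = ⟨g₁ ⌣ g₂, [X]⟩ = ±1` (`abs_cupPairing_g`; `k` even for `⟨g₂ ⌣ g₁, [X]⟩ = r`): the
  orientation datum `uᵥ ⌢ πᵥ₊ ẑ = r tᵥ` of the Kronecker table, `tᵥ = c₊(diag₊[S])` being the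
  collapsed core sphere;
* `SphereProd.kroneckerPairing_thomClass_map_y`, `…_map_sliceAt`, `…_map_y_add_y`,
  `map_thomCollapse_comp_diagX` — **the Kronecker numbers** `⟨ξ, c₊ yₐ⟩ = 1`, equally for the
  slices through any pole `e` (a fibre sphere: Kosinski VI.(12.3), one transverse crossing), and
  `⟨ξ, c₊(y₁ + y₂)⟩ = 2` with `c₊(y₁ + y₂) = (c ∘ diag)₊[S]` (the zero section: VI.(12.4),
  `φ_*(τ₂ₙ) = 2`);
* `SphereProd.eq_zero_of_zsmul_map_y_add_y_eq_zero` — `c₊(y₁ + y₂)` is not torsion.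

Everything is proved; no definitions, no named facts (D-0026).

## References

* A. Kosinski, *Differential Manifolds* (1993), VI.12, (12.3)–(12.4), p. 121. [Kosinski1993]
* J. Milnor, J. Stasheff, *Characteristic classes* (1974), §11 (Thm. 11.1, Cor. 11.2, the dual
  class and the Thom class; Problem 11-C). [MilnorStasheff1974]
* A. Hatcher, *Algebraic Topology* (2002), Example 3.11, §3.3 p. 241 (`⟨a ⌣ b, c⟩ = ⟨b, a ⌢ c⟩`,
  projection formula). [HatcherAT2002]
-/

open scoped Manifold ContDiff Topology
open Set Function CategoryTheory CategoryTheory.Limits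

noncomputable section

universe u

namespace Literature.Topology.FourManifolds

open Literature.AlgebraicTopology.SingularHomology

namespace SphereProd

variable {k : ℕ}

/-! ### Poincaré duals of the factors and the diagonal class -/

/-- **The Poincaré dual of `g₁` is `⟨g₁ ⌣ g₂, [X]⟩ • y₂`, that of `g₂` is
`⟨g₂ ⌣ g₁, [X]⟩ • y₁`**: a class of `Hₖ(Sᵏ × Sᵏ)` is `Σ ⟨g_b, -⟩ y_b`
(`eq_sum_kroneckerPairing_smul_y`), `⟨g_b, gₐ ⌢ [X]⟩ = ⟨gₐ ⌣ g_b, [X]⟩`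
(`kroneckerPairing_cupProduct`) and `gₐ ⌣ gₐ = 0`. [cite: HatcherAT2002, Example 3.11 and §3.3 p. 241] -/
theorem capProduct_g_fundamentalClass (hk : 2 ≤ k) {D : ℕ} (hD : k + k = D)
    (μ : HomologicalOrientation ℤ ((Metric.sphere (0 : EuclideanSpace ℝ (Fin (k + 1))) 1) ×
      (Metric.sphere (0 : EuclideanSpace ℝ (Fin (k + 1))) 1)) D) (a b : Fin 2) (hab : a ≠ b) :
    capProduct hD (g hk a) μ.fundamentalClass =
      (kroneckerPairing ℤ ℤ _ D (cupProduct hD (g hk a) (g hk b)) μ.fundamentalClass : ℤ) •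
        y hk b := by
  subst hD
  have hself : kroneckerPairing ℤ ℤ _ k (g hk a) (capProduct rfl (g hk a) μ.fundamentalClass) = 0 := by
    rw [← kroneckerPairing_cupProduct, cupProduct_g_self hk a, map_zero, LinearMap.zero_apply]
  have hother : kroneckerPairing ℤ ℤ _ k (g hk b) (capProduct rfl (g hk a) μ.fundamentalClass) =
      kroneckerPairing ℤ ℤ _ (k + k) (cupProduct rfl (g hk a) (g hk b)) μ.fundamentalClass := by
    rw [← kroneckerPairing_cupProduct]
  rw [eq_sum_kroneckerPairing_smul_y hk (capProduct rfl (g hk a) μ.fundamentalClass)]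
  fin_cases a <;> fin_cases b
  · exact absurd rfl hab
  · simp only [Fin.zero_eta, Fin.mk_one] at hself hother ⊢
    rw [hself, hother, zero_zsmul, zero_add]
  · simp only [Fin.zero_eta, Fin.mk_one] at hself hother ⊢
    rw [hself, hother, zero_zsmul, add_zero]
  · exact absurd rfl hab

/-- **`diag₊[S] = y₁ + y₂`** (`⟨gₐ, diag₊[S]⟩ = 1` for both `a`, `kroneckerPairing_g_diag`).
[cite: HatcherAT2002, Example 3.11] -/
theorem map_diagX_fundamentalClass (hk : 2 ≤ k) :
    singularHomology.map ℤ ℤ (diagX k) k (μS hk).fundamentalClass = y hk 0 + y hk 1 := by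
  rw [eq_sum_kroneckerPairing_smul_y hk (singularHomology.map ℤ ℤ (diagX k) k _),
    kroneckerPairing_g_diag hk 0, kroneckerPairing_g_diag hk 1, one_smul, one_smul]


/-- **Every horizontal slice `x ↦ (x, e)` carries the class `y₁`** (slices through different
points are homotopic, `k ≥ 1`). [cite: HatcherAT2002, Example 3.11] -/
theorem map_horizSliceAt_fundamentalClass (hk : 2 ≤ k)
    (e : Metric.sphere (0 : EuclideanSpace ℝ (Fin (k + 1))) 1) :
    singularHomology.map ℤ ℤ (⟨fun x => (x, e), by fun_prop⟩ : C(Metric.sphere (0 : EuclideanSpace ℝ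
      (Fin (k + 1))) 1, (Metric.sphere (0 : EuclideanSpace ℝ (Fin (k + 1))) 1) ×
        (Metric.sphere (0 : EuclideanSpace ℝ (Fin (k + 1))) 1))) k (μS hk).fundamentalClass = y hk 0 := by
  rw [singularHomology.map_eq_of_homotopic ℤ ℤ (homotopic_horizSlice (by omega) e (southPole k)) k]
  rfl

/-- **Every vertical slice `x ↦ (e, x)` carries the class `y₂`** (`k ≥ 1`).
[cite: HatcherAT2002, Example 3.11] -/
theorem map_vertSliceAt_fundamentalClass (hk : 2 ≤ k)
    (e : Metric.sphere (0 : EuclideanSpace ℝ (Fin (k + 1))) 1) :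
    singularHomology.map ℤ ℤ (⟨fun x => (e, x), by fun_prop⟩ : C(Metric.sphere (0 : EuclideanSpace ℝ
      (Fin (k + 1))) 1, (Metric.sphere (0 : EuclideanSpace ℝ (Fin (k + 1))) 1) ×
        (Metric.sphere (0 : EuclideanSpace ℝ (Fin (k + 1))) 1))) k (μS hk).fundamentalClass = y hk 1 := by
  rw [singularHomology.map_eq_of_homotopic ℤ ℤ (homotopic_vertSlice (by omega) e (southPole k)) k]
  rfl

/-! ### The Thom class against the collapsed classes -/

section ThomCollapse

variable {N : Set ((Metric.sphere (0 : EuclideanSpace ℝ (Fin (k + 1))) 1) ×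
    (Metric.sphere (0 : EuclideanSpace ℝ (Fin (k + 1))) 1))}
  (hNo : IsOpen N) {Y : Type} [TopologicalSpace Y] (φ : ↥N ≃ₜ Y)

/-- **`ξ ⌢ c₊[X] = r • c₊(y₁ + y₂)` with `r = ⟨g₁ ⌣ g₂, [X]⟩`** (`k ≥ 2` even): by the
projection formula `ξ ⌢ c₊[X] = c₊(c^*ξ ⌢ [X]) = c₊((g₁ + g₂) ⌢ [X])`, and
`(g₁ + g₂) ⌢ [X] = ⟨g₁ ⌣ g₂, [X]⟩ y₂ + ⟨g₂ ⌣ g₁, [X]⟩ y₁ = r (y₁ + y₂)` (graded commutativity,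
`k` even). The Poincaré dual of the Thom class is the collapsed zero section up to the model sign
`r = ±1` (Milnor–Stasheff Thm. 11.1 / Problem 11-C). [cite: MilnorStasheff1974, §11 Thm. 11.1] [cite: HatcherAT2002, §3.3 p. 241] -/
theorem capProduct_thomClass_map_fundamentalClass (hk : 2 ≤ k) (hke : Even k)
    (hΔ : diagonal k ⊆ N) {D : ℕ} (hD : k + k = D)
    (μ : HomologicalOrientation ℤ ((Metric.sphere (0 : EuclideanSpace ℝ (Fin (k + 1))) 1) ×
      (Metric.sphere (0 : EuclideanSpace ℝ (Fin (k + 1))) 1)) D)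
    {ξ : ↥(singularCohomology ℤ ℤ (OnePoint Y) k)}
    (hξA : singularCohomology.map ℤ ℤ (thomIncl φ) k ξ =
      singularCohomology.map ℤ ℤ (subsetIncl N) k (g hk 0 + g hk 1))
    (hξB : singularCohomology.map ℤ ℤ (subsetIncl (thomDiag φ)ᶜ) k ξ = 0) :
    capProduct hD ξ (singularHomology.map ℤ ℤ (thomCollapse hNo φ) D μ.fundamentalClass) =
      (kroneckerPairing ℤ ℤ _ D (cupProduct hD (g hk 0) (g hk 1)) μ.fundamentalClass : ℤ) •
        singularHomology.map ℤ ℤ (thomCollapse hNo φ) k (y hk 0 + y hk 1) := by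
  have hc := map_thomCollapse_thomClass hNo φ hk hke hΔ hξA hξB
  rw [← capProduct_map (thomCollapse hNo φ) hD ξ, hc, map_add, LinearMap.add_apply,
    capProduct_g_fundamentalClass hk hD μ 0 1 (by decide),
    capProduct_g_fundamentalClass hk hD μ 1 0 (by decide)]
  -- graded commutativity: `⟨g₂ ⌣ g₁, [X]⟩ = ⟨g₁ ⌣ g₂, [X]⟩` for `k` even
  have hcomm : kroneckerPairing ℤ ℤ _ D (cupProduct hD (g hk 1) (g hk 0)) μ.fundamentalClass =
      kroneckerPairing ℤ ℤ _ D (cupProduct hD (g hk 0) (g hk 1)) μ.fundamentalClass := by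
    rw [cupProduct_gradedComm_holds ℤ _ hD hD (g hk 1) (g hk 0), LinearMap.map_smul,
      LinearMap.smul_apply, smul_eq_mul, Even.neg_one_pow (hke.mul_right k), one_mul]
  rw [hcomm, ← zsmul_add, map_zsmul, add_comm (y hk 1) (y hk 0)]

/-- **The Kronecker number of the Thom class on a collapsed factor is `1`**:
`⟨ξ, c₊ yₐ⟩ = ⟨c^*ξ, yₐ⟩ = ⟨g₁ + g₂, yₐ⟩ = 1` (a fibre sphere of the tube meets the zero section
once: Kosinski VI.(12.3)). [cite: Kosinski1993, VI.(12.3)] [cite: HatcherAT2002, Example 3.11] -/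
theorem kroneckerPairing_thomClass_map_y (hk : 2 ≤ k) (hke : Even k) (hΔ : diagonal k ⊆ N)
    {ξ : ↥(singularCohomology ℤ ℤ (OnePoint Y) k)}
    (hξA : singularCohomology.map ℤ ℤ (thomIncl φ) k ξ =
      singularCohomology.map ℤ ℤ (subsetIncl N) k (g hk 0 + g hk 1))
    (hξB : singularCohomology.map ℤ ℤ (subsetIncl (thomDiag φ)ᶜ) k ξ = 0) (a : Fin 2) :
    kroneckerPairing ℤ ℤ (OnePoint Y) k ξ
      (singularHomology.map ℤ ℤ (thomCollapse hNo φ) k (y hk a)) = 1 := by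
  rw [← kroneckerPairing_map, map_thomCollapse_thomClass hNo φ hk hke hΔ hξA hξB, map_add,
    LinearMap.add_apply, kroneckerPairing_g_y, kroneckerPairing_g_y]
  fin_cases a <;> simp


/-- The same for the slices through any point `e`: **`⟨ξ, c₊ (· , e)₊[S]⟩ = ⟨ξ, c₊ (e, ·)₊[S]⟩ = 1`**
— the fibres of the tube over a plumbing pole (Kosinski VI.(12.3)). [cite: Kosinski1993, VI.(12.3)] -/
theorem kroneckerPairing_thomClass_map_sliceAt (hk : 2 ≤ k) (hke : Even k) (hΔ : diagonal k ⊆ N)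
    {ξ : ↥(singularCohomology ℤ ℤ (OnePoint Y) k)}
    (hξA : singularCohomology.map ℤ ℤ (thomIncl φ) k ξ =
      singularCohomology.map ℤ ℤ (subsetIncl N) k (g hk 0 + g hk 1))
    (hξB : singularCohomology.map ℤ ℤ (subsetIncl (thomDiag φ)ᶜ) k ξ = 0)
    (e : Metric.sphere (0 : EuclideanSpace ℝ (Fin (k + 1))) 1) :
    kroneckerPairing ℤ ℤ (OnePoint Y) k ξ (singularHomology.map ℤ ℤ
        ((thomCollapse hNo φ).comp ⟨fun x => (x, e), by fun_prop⟩) k (μS hk).fundamentalClass) = 1 ∧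
    kroneckerPairing ℤ ℤ (OnePoint Y) k ξ (singularHomology.map ℤ ℤ
        ((thomCollapse hNo φ).comp ⟨fun x => (e, x), by fun_prop⟩) k (μS hk).fundamentalClass) = 1 := by
  constructor
  · rw [singularHomology.map_comp, ModuleCat.comp_apply, map_horizSliceAt_fundamentalClass hk e]
    exact kroneckerPairing_thomClass_map_y hNo φ hk hke hΔ hξA hξB 0
  · rw [singularHomology.map_comp, ModuleCat.comp_apply, map_vertSliceAt_fundamentalClass hk e]
    exact kroneckerPairing_thomClass_map_y hNo φ hk hke hΔ hξA hξB 1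

/-- And for the diagonal: **`⟨ξ, (c ∘ diag)₊[S]⟩ = 2`**, with `(c ∘ diag)₊[S] = c₊(y₁ + y₂)` the
collapsed core sphere (Kosinski VI.(12.4)). [cite: Kosinski1993, VI.(12.4)] -/
theorem map_thomCollapse_comp_diagX (hk : 2 ≤ k) :
    singularHomology.map ℤ ℤ ((thomCollapse hNo φ).comp (diagX k)) k (μS hk).fundamentalClass =
      singularHomology.map ℤ ℤ (thomCollapse hNo φ) k (y hk 0 + y hk 1) := by
  rw [singularHomology.map_comp, ModuleCat.comp_apply, map_diagX_fundamentalClass hk]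

/-- **The Kronecker number of the Thom class on the collapsed diagonal is `2`**:
`⟨ξ, c₊(y₁ + y₂)⟩ = 2` (the zero section of the tangent disc bundle of `S²ⁿ`:
Kosinski VI.(12.4), `φ_*(τ₂ₙ) = 2`). [cite: Kosinski1993, VI.(12.4)] [cite: MilnorStasheff1974, §11 Cor. 11.2] -/
theorem kroneckerPairing_thomClass_map_y_add_y (hk : 2 ≤ k) (hke : Even k) (hΔ : diagonal k ⊆ N)
    {ξ : ↥(singularCohomology ℤ ℤ (OnePoint Y) k)}
    (hξA : singularCohomology.map ℤ ℤ (thomIncl φ) k ξ =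
      singularCohomology.map ℤ ℤ (subsetIncl N) k (g hk 0 + g hk 1))
    (hξB : singularCohomology.map ℤ ℤ (subsetIncl (thomDiag φ)ᶜ) k ξ = 0) :
    kroneckerPairing ℤ ℤ (OnePoint Y) k ξ
      (singularHomology.map ℤ ℤ (thomCollapse hNo φ) k (y hk 0 + y hk 1)) = 2 := by
  rw [map_add, map_add, kroneckerPairing_thomClass_map_y hNo φ hk hke hΔ hξA hξB,
    kroneckerPairing_thomClass_map_y hNo φ hk hke hΔ hξA hξB]
  rfl

/-- **`c₊(y₁ + y₂)` is not a torsion class**: `a • c₊(y₁ + y₂) = 0` forces `2a = 0`.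
[cite: Kosinski1993, VI.(12.4)] -/
theorem eq_zero_of_zsmul_map_y_add_y_eq_zero (hk : 2 ≤ k) (hke : Even k) (hΔ : diagonal k ⊆ N)
    {ξ : ↥(singularCohomology ℤ ℤ (OnePoint Y) k)}
    (hξA : singularCohomology.map ℤ ℤ (thomIncl φ) k ξ =
      singularCohomology.map ℤ ℤ (subsetIncl N) k (g hk 0 + g hk 1))
    (hξB : singularCohomology.map ℤ ℤ (subsetIncl (thomDiag φ)ᶜ) k ξ = 0) (a : ℤ)
    (ha : a • singularHomology.map ℤ ℤ (thomCollapse hNo φ) k (y hk 0 + y hk 1) = 0) : a = 0 := by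
  have e := congrArg (kroneckerPairing ℤ ℤ (OnePoint Y) k ξ) ha
  rw [map_zsmul, kroneckerPairing_thomClass_map_y_add_y hNo φ hk hke hΔ hξA hξB, map_zero,
    zsmul_eq_mul] at e
  simpa using e

/-- **The model sign is `±1`**: `|⟨g₁ ⌣ g₂, [X]⟩| = 1` for every orientation of `Sᵏ × Sᵏ` in
degree `D = k + k` (`abs_cupPairing_g`, Poincaré duality). [cite: HatcherAT2002, Example 3.11 and Cor. 3.39] -/
theorem abs_kroneckerPairing_cupProduct_g (hk : 2 ≤ k) {D : ℕ} (hD : k + k = D)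
    (μ : HomologicalOrientation ℤ ((Metric.sphere (0 : EuclideanSpace ℝ (Fin (k + 1))) 1) ×
      (Metric.sphere (0 : EuclideanSpace ℝ (Fin (k + 1))) 1)) D) :
    |kroneckerPairing ℤ ℤ _ D (cupProduct hD (g hk 0) (g hk 1)) μ.fundamentalClass| = 1 := by
  subst hD
  rw [← cupPairing_apply]
  exact abs_cupPairing_g hk μ

end ThomCollapse

end SphereProd

end Literature.Topology.FourManifolds
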